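import Literature.NumberTheory.EllipticCurves.BinaryQuarticMinimisationPrimeProofs
import HarnessLib

/-!
# Birch–Swinnerton-Dyer's minimisation lemma at `p = 3` (Bhargava–Shankar, Lemma 5.4), proved
# following Stoll–Cremona

`Proofs` companion of `Literature/NumberTheory/EllipticCurves/BinaryQuarticMinimisation.lean`,
discharging the named fact `Literature.NumberTheory.EllipticCurves.bsd_minimisation_three`
(Bhargava–Shankar, held arXiv text Lemma 5.4 = Birch–Swinnerton-Dyer, *Notes on elliptic
curves. I* (1963), Lemma 4): *an integral binary quartic form `f` with `3⁵ ∣ I(f)`, `3⁹ ∣ J(f)`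
such that `z² = f(x, y)` is soluble over `ℚ₃` is equivalent to an integral form with invariants
`3⁻⁴ I(f)`, `3⁻⁶ J(f)`.* Sequel of `BinaryQuarticMinimisationPrimeProofs.lean` (the case
`p ≥ 5`), whose toolkit (the three moves of Stoll–Cremona's Lemma A.1, the divisibility
bookkeeping, the `ℚ_p`-insolubility step) is reused.

## Source followed

M. Stoll, J. E. Cremona, *Minimal models for 2-coverings of elliptic curves*, LMS J. Comput.
Math. 5 (2002) 220–243 (held), Prop. 4.3 and **Proposition A.4** (p. 239: "This is [BSD,
Lemma 4]. In [BSD] the proof was omitted"), sufficiency part, in the case `v(I) ≥ 5`,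
`v(J) ≥ 9`, over `K = ℚ₃`. As for `p ≥ 5`, all moves lower `(I, J)` by exactly `(3⁴, 3⁶)` and
all normalisations are in `SL₂(ℤ)`, so the printed proof gives the exact statement.

## Proof architecture (Prop. A.4, p. 239)

* **The multiple root modulo `3`.** Here `I ≡ c²`, `J ≡ c³ (mod 3)`, so `3 ∣ I` only gives
  `3 ∣ c`; the multiple root comes from the discriminant: `27Δ = 4I³ − J²` gives `3 ∣ Δ`, and
  modulo `3`, for `c ≡ 0`, `Δ ≡ (ae − bd)³`; a nonzero form `a x⁴ + b x³y + d xy³ + e y⁴` over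
  `𝔽₃` with `ae = bd` is `ℓ₁ ℓ₂³` for `𝔽₃`-rational linear forms (cubes being trivial in `𝔽₃`),
  whence the same two normal shapes `a x⁴`, `b x³ y` as for `p ≥ 5` (`normalForm₃`,
  `exists_sl2_shape₃`; the `𝔽₃`-arithmetic is checked by `decide`).
* **The valuation chases** of the printed proof with `v(3) = 1` (`v(12) = 1`, `v(9) = v(72) = 2`,
  `v(27) = 3`): `chase_quadruple₀₃` (the case "handled in a similar way" in the text, after
  first improving `v(b) ≥ 2` by a shear), `chase_triple₀₃`/`chase_triple₀₃'` (before/after the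
  shear `bt ≡ −c/9 (mod 3)`), `chase_triple₁₃`, `chase_quadruple₁₃`, and the two shear
  parameters (`exists_shear_b₃`, `exists_shear_c₃`).
* **Assembly** (`bsd_minimisation_three_holds`): `v(Q) ≥ 2` ⇒ `Q/9`; `v(Q) = 0`, quadruple ⇒
  `v ≥ (0,2,3,3,4)` ⇒ `Q(x, z/3)`; `v(Q) = 0`, triple ⇒ `v ≥ (1,0,3,4,6)` ⇒ `9Q(x, z/9)`;
  `v(Q) = 1`, triple ⇒ `v ≥ (2,1,3,3,4)` ⇒ `Q(x, z/3)`; `v(Q) = 1`, quadruple ⇒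
  `v ≥ (1,2,3,3,3)` and `v(e) = 3` is excluded by `ℚ₃`-solubility ⇒ `Q(x, z/3)`.

## References

* [StollCremona2002] M. Stoll, J. E. Cremona, LMS J. Comput. Math. 5 (2002) 220–243,
  doi:10.1112/S1461157000000760: Prop. 4.3, Lemma A.1, Prop. A.4 (p. 239).
* [BhargavaShankarAnnals2015] M. Bhargava, A. Shankar, Ann. of Math. (2) 181 (2015) 191–242 =
  arXiv:1006.1002, Lemma 5.4 (arXiv:1006.1002v2 numbering).
* B. J. Birch, H. P. F. Swinnerton-Dyer, *Notes on elliptic curves. I*, J. reine angew. Math. 212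
  (1963) 7–25, Lemma 4 (not held; quoted through the two sources above).
-/

noncomputable section

namespace Literature.NumberTheory.EllipticCurves

namespace BinaryQuartic

/-! ## 𝔽₃-arithmetic (checked by `decide`, before any classical instances are opened) -/

/-- The shear computations behind `normalForm₃`: for `a ≠ 0`, `ae = bd` in `𝔽₃` and
`r = −d/a = −da`, the form `a x⁴ + b x³y + d xy³ + e y⁴` becomes `a x⁴ + (b − d) x³ y` under
`(x, y) ↦ (x + r y, y)` (all of `𝔽₃` is checked). [folklore] -/
theorem f3_lowerShear_identities :
    ∀ a b d e : ZMod 3, a ≠ 0 → a * e = b * d →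
      4 * a * (-(d * a)) + b = b - d ∧
      6 * a * (-(d * a)) ^ 2 + 3 * b * (-(d * a)) + 0 = 0 ∧
      4 * a * (-(d * a)) ^ 3 + 3 * b * (-(d * a)) ^ 2 + 2 * 0 * (-(d * a)) + d = 0 ∧
      a * (-(d * a)) ^ 4 + b * (-(d * a)) ^ 3 + 0 * (-(d * a)) ^ 2 + d * (-(d * a)) + e = 0 := by
  decide

/-- The upper shear killing the `x⁴`-coefficient: `a + b t = 0` for `t = −a/b = −ab`, `b ≠ 0` in
`𝔽₃`. [folklore] -/
theorem f3_upperShear_identity :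
    ∀ a b : ZMod 3, b ≠ 0 → a + b * (-(a * b)) + 0 * (-(a * b)) ^ 2 + 0 * (-(a * b)) ^ 3 +
      0 * (-(a * b)) ^ 4 = 0 := by
  decide

open scoped Classical

/-! ## §C₃ Normal forms over `𝔽₃` -/

section NormalFormThree

/-- **Normal form over `𝔽₃`, leading coefficient nonzero**: a form `a x⁴ + b x³ y + d x y³ + e y⁴`
(`c = 0`) with `a ≠ 0` and `ae = bd` equals `a⁻¹ (a x + b y)(a x + d y)³` over `𝔽₃`; the shear
`x ↦ x − (d/a) y` followed, when `b ≠ d`, by `y ↦ y − (a/(b−d)) x` brings it to `a x⁴` or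
`(b − d) x³ y` (Stoll–Cremona, proof of Prop. A.4: "we may suppose that the multiple root modulo
`3` is at `0`, and that if the multiplicity is exactly `3` then the second root is at `∞`").
[cite: StollCremona2002, Prop. A.4 (proof)] -/
theorem normalForm₃_of_a_ne_zero (g : BinaryQuartic (ZMod 3)) (ha : g.a ≠ 0) (hc : g.c = 0)
    (hdisc : g.a * g.e = g.b * g.d) :
    ∃ (r t : ZMod 3) (h : BinaryQuartic (ZMod 3)),
      g.subst (!![1, t; 0, 1] * !![1, 0; r, 1]) = h ∧
      ((h.b = 0 ∧ h.c = 0 ∧ h.d = 0 ∧ h.e = 0 ∧ h.a ≠ 0) ∨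
        (h.a = 0 ∧ h.c = 0 ∧ h.d = 0 ∧ h.e = 0 ∧ h.b ≠ 0)) := by
  obtain ⟨a, b, c, d, e⟩ := g
  simp only at ha hc hdisc
  subst hc
  obtain ⟨k1, k2, k3, k4⟩ := f3_lowerShear_identities a b d e ha hdisc
  have hg₁ : (⟨a, b, 0, d, e⟩ : BinaryQuartic (ZMod 3)).subst !![1, 0; -(d * a), 1] =
      ⟨a, b - d, 0, 0, 0⟩ := by
    rw [subst_lowerShear]
    ext
    · rfl
    · exact k1
    · exact k2
    · exact k3
    · exact k4
  by_cases hbd : b - d = 0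
  · refine ⟨-(d * a), 0, ⟨a, b - d, 0, 0, 0⟩, ?_, Or.inl ⟨hbd, rfl, rfl, rfl, ha⟩⟩
    rw [← Matrix.one_fin_two, one_mul, hg₁]
  · have k5 := f3_upperShear_identity a (b - d) hbd
    have hg₂ : (⟨a, b - d, 0, 0, 0⟩ : BinaryQuartic (ZMod 3)).subst !![1, -(a * (b - d)); 0, 1] =
        ⟨0, b - d, 0, 0, 0⟩ := by
      rw [subst_upperShear]
      ext
      · exact k5
      · show b - d + 2 * 0 * (-(a * (b - d))) + 3 * 0 * (-(a * (b - d))) ^ 2 +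
          4 * 0 * (-(a * (b - d))) ^ 3 = b - d
        ring
      · show (0 : ZMod 3) + 3 * 0 * (-(a * (b - d))) + 6 * 0 * (-(a * (b - d))) ^ 2 = 0
        ring
      · show (0 : ZMod 3) + 4 * 0 * (-(a * (b - d))) = 0
        ring
      · rfl
    refine ⟨-(d * a), -(a * (b - d)), ⟨0, b - d, 0, 0, 0⟩, ?_, Or.inr ⟨rfl, rfl, rfl, rfl, hbd⟩⟩
    rw [subst_mul, hg₁, hg₂]

/-- **Normal form over `𝔽₃`**: a nonzero form with `c = 0` and `ae = bd` (i.e. `Δ = (ae − bd)³ = 0`)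
has an `𝔽₃`-rational root of multiplicity `≥ 3`, and shears and the rotation bring it to `a x⁴`
(`a ≠ 0`) or `b x³ y` (`b ≠ 0`) (Stoll–Cremona, proof of Prop. A.4).
[cite: StollCremona2002, Prop. A.4 (proof)] -/
theorem normalForm₃ (g : BinaryQuartic (ZMod 3))
    (hg : g.a ≠ 0 ∨ g.b ≠ 0 ∨ g.c ≠ 0 ∨ g.d ≠ 0 ∨ g.e ≠ 0) (hc : g.c = 0)
    (hdisc : g.a * g.e = g.b * g.d) :
    ∃ (r t : ZMod 3) (ε : ℕ) (h : BinaryQuartic (ZMod 3)),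
      g.subst (!![1, t; 0, 1] * !![1, 0; r, 1] * !![0, 1; -1, 0] ^ ε) = h ∧
      ((h.b = 0 ∧ h.c = 0 ∧ h.d = 0 ∧ h.e = 0 ∧ h.a ≠ 0) ∨
        (h.a = 0 ∧ h.c = 0 ∧ h.d = 0 ∧ h.e = 0 ∧ h.b ≠ 0)) := by
  by_cases ha : g.a ≠ 0
  · obtain ⟨r, t, h, hh, hshape⟩ := normalForm₃_of_a_ne_zero g ha hc hdisc
    exact ⟨r, t, 0, h, by rw [pow_zero, mul_one, hh], hshape⟩
  rw [not_ne_iff] at ha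
  by_cases he : g.e ≠ 0
  · set g' := g.subst !![0, 1; -1, 0] with hg'
    have hg'' : g' = ⟨g.e, -g.d, g.c, -g.b, g.a⟩ := by rw [hg', subst_swap]
    have ha' : g'.a ≠ 0 := by rw [hg'']; exact he
    have hc' : g'.c = 0 := by rw [hg'']; exact hc
    have hdisc' : g'.a * g'.e = g'.b * g'.d := by
      rw [hg'']
      show g.e * g.a = -g.d * -g.b
      linear_combination hdisc
    obtain ⟨r, t, h, hh, hshape⟩ := normalForm₃_of_a_ne_zero g' ha' hc' hdisc'
    refine ⟨r, t, 1, h, ?_, hshape⟩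
    rw [pow_one, subst_mul, ← hg', hh]
  rw [not_ne_iff] at he
  obtain ⟨a, b, c, d, e⟩ := g
  simp only at ha he hg hc hdisc
  subst ha he hc
  have hbd : b * d = 0 := by linear_combination (-1 : ZMod 3) * hdisc
  by_cases hd : d = 0
  · subst hd
    have hb : b ≠ 0 := by
      rintro rfl; simp at hg
    refine ⟨0, 0, 0, ⟨0, b, 0, 0, 0⟩, ?_, Or.inr ⟨rfl, rfl, rfl, rfl, hb⟩⟩
    rw [pow_zero, mul_one, ← Matrix.one_fin_two, one_mul, subst_one]
  · have hb : b = 0 := by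
      rcases mul_eq_zero.mp hbd with h | h
      · exact h
      · exact absurd h hd
    subst hb
    refine ⟨0, 0, 1, ⟨0, -d, 0, 0, 0⟩, ?_, Or.inr ⟨rfl, rfl, rfl, rfl, neg_ne_zero.mpr hd⟩⟩
    rw [pow_one, ← Matrix.one_fin_two, one_mul, one_mul, subst_swap]
    ext <;> simp

/-- **The multiple root modulo `3`, integrally**: for an integral form `f`, nonzero modulo `3`,
with `3 ∣ c` and `3 ∣ ae − bd`, there is `M ∈ SL₂(ℤ)` with `f · M ≡ a x⁴` (`3 ∤ a`) or
`≡ b x³ y` (`3 ∤ b`) modulo `3` (Stoll–Cremona, proof of Prop. A.4).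
[cite: StollCremona2002, Prop. A.4 (proof)] -/
theorem exists_sl2_shape₃ (f : BinaryQuartic ℤ)
    (hf : ¬ ((3 : ℤ) ∣ f.a ∧ (3 : ℤ) ∣ f.b ∧ (3 : ℤ) ∣ f.c ∧ (3 : ℤ) ∣ f.d ∧ (3 : ℤ) ∣ f.e))
    (hc : (3 : ℤ) ∣ f.c) (hdisc : (3 : ℤ) ∣ f.a * f.e - f.b * f.d) :
    ∃ M : Matrix (Fin 2) (Fin 2) ℤ, M.det = 1 ∧
      ((¬ (3 : ℤ) ∣ (f.subst M).a ∧ (3 : ℤ) ∣ (f.subst M).b ∧ (3 : ℤ) ∣ (f.subst M).c ∧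
          (3 : ℤ) ∣ (f.subst M).d ∧ (3 : ℤ) ∣ (f.subst M).e) ∨
        ((3 : ℤ) ∣ (f.subst M).a ∧ ¬ (3 : ℤ) ∣ (f.subst M).b ∧ (3 : ℤ) ∣ (f.subst M).c ∧
          (3 : ℤ) ∣ (f.subst M).d ∧ (3 : ℤ) ∣ (f.subst M).e)) := by
  set φ := Int.castRingHom (ZMod 3) with hφ
  have hdvd : ∀ z : ℤ, φ z = 0 ↔ (3 : ℤ) ∣ z := fun z ↦ by
    rw [hφ, eq_intCast, ZMod.intCast_zmod_eq_zero_iff_dvd]; norm_num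
  set g := f.map φ with hg
  have hg0 : g.a ≠ 0 ∨ g.b ≠ 0 ∨ g.c ≠ 0 ∨ g.d ≠ 0 ∨ g.e ≠ 0 := by
    simp only [hg, map_a, map_b, map_c, map_d, map_e, ne_eq, hdvd]
    tauto
  have hgc : g.c = 0 := by rw [hg, map_c, hdvd]; exact hc
  have hgdisc : g.a * g.e = g.b * g.d := by
    rw [← sub_eq_zero]
    have : φ (f.a * f.e - f.b * f.d) = 0 := (hdvd _).mpr hdisc
    simpa [hg, map_sub, map_mul] using this
  obtain ⟨r, t, ε, h, hh, hshape⟩ := normalForm₃ g hg0 hgc hgdisc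
  set M : Matrix (Fin 2) (Fin 2) ℤ :=
    !![1, (t.val : ℤ); 0, 1] * !![1, 0; (r.val : ℤ), 1] * !![0, 1; -1, 0] ^ ε with hM
  have hMdet : M.det = 1 := by
    rw [hM, Matrix.det_mul, Matrix.det_mul, Matrix.det_pow, det_upperShear, det_lowerShear,
      det_swap]
    simp
  have hMmap : M.map φ = !![1, t; 0, 1] * !![1, 0; r, 1] * !![0, 1; -1, 0] ^ ε := by
    rw [← RingHom.mapMatrix_apply, hM, map_mul, map_mul, map_pow]
    simp only [RingHom.mapMatrix_apply, map_fin_two]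
    simp [hφ]
  have hsub : (f.subst M).map φ = h := by rw [map_subst, hMmap, ← hg, hh]
  have ca : (3 : ℤ) ∣ (f.subst M).a ↔ h.a = 0 := by rw [← hdvd, ← map_a φ (f.subst M), hsub]
  have cb : (3 : ℤ) ∣ (f.subst M).b ↔ h.b = 0 := by rw [← hdvd, ← map_b φ (f.subst M), hsub]
  have cc : (3 : ℤ) ∣ (f.subst M).c ↔ h.c = 0 := by rw [← hdvd, ← map_c φ (f.subst M), hsub]
  have cd : (3 : ℤ) ∣ (f.subst M).d ↔ h.d = 0 := by rw [← hdvd, ← map_d φ (f.subst M), hsub]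
  have ce : (3 : ℤ) ∣ (f.subst M).e ↔ h.e = 0 := by rw [← hdvd, ← map_e φ (f.subst M), hsub]
  refine ⟨M, hMdet, ?_⟩
  rw [ca, cb, cc, cd, ce]
  rcases hshape with ⟨hb, hc, hd, he, ha⟩ | ⟨ha, hc, hd, he, hb⟩
  · exact Or.inl ⟨ha, hb, hc, hd, he⟩
  · exact Or.inr ⟨ha, hb, hc, hd, he⟩

end NormalFormThree

/-! ## The discriminant modulo `3` -/

/-- `Δ ≡ (ae − bd)³ (mod 3, c)`: an explicit integral identity
`Δ − (ae − bd)³ = 3A + cB` gives `3 ∣ ae − bd` from `3 ∣ c`, `3 ∣ Δ` (the Frobenius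
`a³e³ − b³d³ = (ae − bd)³` of `𝔽₃`). [folklore] -/
theorem three_dvd_of_dvd_disc (f : BinaryQuartic ℤ) (hc : (3 : ℤ) ∣ f.c) (hΔ : (3 : ℤ) ∣ f.disc) :
    (3 : ℤ) ∣ f.a * f.e - f.b * f.d := by
  have key : (f.a * f.e - f.b * f.d) ^ 3 = f.disc - 3 * (85 * f.a ^ 3 * f.e ^ 3
      - 63 * f.a ^ 2 * f.b * f.d * f.e ^ 2 - 9 * f.a ^ 2 * f.d ^ 4 - 3 * f.a * f.b ^ 2 * f.d ^ 2 * f.e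
      - 9 * f.b ^ 4 * f.e ^ 2 - f.b ^ 3 * f.d ^ 3) - f.c * (-128 * f.a ^ 2 * f.c * f.e ^ 2
      + 144 * f.a ^ 2 * f.d ^ 2 * f.e + 144 * f.a * f.b ^ 2 * f.e ^ 2 - 80 * f.a * f.b * f.c * f.d * f.e
      + 18 * f.a * f.b * f.d ^ 3 + 16 * f.a * f.c ^ 3 * f.e - 4 * f.a * f.c ^ 2 * f.d ^ 2
      + 18 * f.b ^ 3 * f.d * f.e - 4 * f.b ^ 2 * f.c ^ 2 * f.e + f.b ^ 2 * f.c * f.d ^ 2) := by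
    simp only [disc]; ring
  refine Int.prime_three.dvd_of_dvd_pow (n := 3) ?_
  rw [key]
  exact dvd_sub (dvd_sub hΔ (dvd_mul_right _ _)) (hc.mul_right _)

/-- From `3⁵ ∣ I`, `3⁹ ∣ J`: `3 ∣ c` and `3¹² ∣ Δ` (as `27Δ = 4I³ − J²`), hence `3 ∣ ae − bd`.
[cite: StollCremona2002, Prop. A.4 (proof)] -/
theorem three_dvd_c_and_disc (f : BinaryQuartic ℤ) (hI : (3 : ℤ) ∣ f.I) (hI3 : (3 : ℤ) ^ 3 ∣ f.I)
    (hJ : (3 : ℤ) ^ 5 ∣ f.J) : (3 : ℤ) ∣ f.c ∧ (3 : ℤ) ∣ f.a * f.e - f.b * f.d := by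
  have hc : (3 : ℤ) ∣ f.c := by
    refine Int.prime_three.dvd_of_dvd_pow (n := 2) ?_
    have e : f.c ^ 2 = f.I - 3 * (4 * f.a * f.e - f.b * f.d) := by simp only [I]; ring
    rw [e]
    exact dvd_sub hI (dvd_mul_right _ _)
  refine ⟨hc, three_dvd_of_dvd_disc f hc ?_⟩
  have h9 : (3 : ℤ) ^ 9 ∣ (3 : ℤ) ^ 3 * f.disc := by
    rw [show (3 : ℤ) ^ 3 * f.disc = 27 * f.disc by norm_num, twentySeven_mul_disc]
    refine dvd_sub ?_ ?_
    · have := (pow_dvd_pow_of_dvd hI3 3).mul_left 4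
      rw [← pow_mul] at this
      exact pow_dvd_of_le this (by norm_num)
    · have := pow_dvd_pow_of_dvd hJ 2
      rw [← pow_mul] at this
      exact pow_dvd_of_le this (by norm_num)
  rw [show (9 : ℕ) = 3 + 6 from rfl, pow_add] at h9
  have h6 : (3 : ℤ) ^ 6 ∣ f.disc := (mul_dvd_mul_iff_left (by norm_num)).mp h9
  exact (dvd_pow_self (3 : ℤ) (by norm_num : (6 : ℕ) ≠ 0)).trans h6

/-! ## §D₃ Divisibility bookkeeping at `3` -/

section Dvd

variable {P : ℤ}

/-- Four factors. [folklore] -/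
theorem pow_dvd_mul₄ {w x y z : ℤ} {h i j l : ℕ} (hw : P ^ h ∣ w) (hx : P ^ i ∣ x)
    (hy : P ^ j ∣ y) (hz : P ^ l ∣ z) (k : ℤ) : P ^ (h + i + j + l) ∣ k * w * x * y * z := by
  rw [pow_add, show k * w * x * y * z = (k * w * x * y) * z by ring]
  exact mul_dvd_mul (pow_dvd_mul₃ hw hx hy k) hz

/-- `P^(3k) ∣ c³` gives `P^k ∣ c`. [folklore] -/
theorem pow_dvd_of_cube {c : ℤ} {k : ℕ} (h : P ^ (3 * k) ∣ c ^ 3) : P ^ k ∣ c := by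
  rw [mul_comm, pow_mul] at h
  exact (Int.pow_dvd_pow_iff three_ne_zero).mp h

/-- `P^(3k+1) ∣ c³` gives `P^(k+1) ∣ c` for `P` prime. [folklore] -/
theorem pow_dvd_of_cube_succ (hP : Prime P) {c : ℤ} {k : ℕ} (h : P ^ (3 * k + 1) ∣ c ^ 3) :
    P ^ (k + 1) ∣ c := by
  obtain ⟨c', rfl⟩ : P ^ k ∣ c := pow_dvd_of_cube (pow_dvd_of_le h (by omega))
  rw [pow_succ]
  refine mul_dvd_mul_left _ (hP.dvd_of_dvd_pow (n := 3) ?_)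
  rw [mul_pow, ← pow_mul, mul_comm k 3, pow_succ] at h
  exact (mul_dvd_mul_iff_left (pow_ne_zero _ hP.ne_zero)).mp h

end Dvd

section Three

/-- Small facts about `3`. [folklore] -/
theorem three_prime_facts : Prime (3 : ℤ) ∧ ¬ (3 : ℤ) ∣ 2 ∧ ¬ (3 : ℤ) ∣ 4 ∧ ¬ (3 : ℤ) ∣ 8 ∧
    (3 : ℤ) ^ 1 ∣ 3 ∧ (3 : ℤ) ^ 2 ∣ 9 ∧ (3 : ℤ) ^ 3 ∣ 27 := by
  refine ⟨Int.prime_three, by decide, by decide, by decide, by norm_num, by norm_num, by norm_num⟩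

/-- Shear parameter for the quadruple-root case: `4 a r ≡ −b (mod 9)` with `3 ∣ r`, for
`3 ∤ a`, `3 ∣ b` (depressing modulo `9`). [folklore] -/
theorem exists_shear_b₃ {a b : ℤ} (ha : ¬ (3 : ℤ) ∣ a) (hb : (3 : ℤ) ∣ b) :
    ∃ r : ℤ, (3 : ℤ) ∣ r ∧ (3 : ℤ) ^ 2 ∣ 4 * a * r + b := by
  obtain ⟨b', rfl⟩ := hb
  have hcop : IsCoprime (3 : ℤ) (4 * a) :=
    (Prime.coprime_iff_not_dvd Int.prime_three).mpr
      (fun h ↦ (Int.prime_three.dvd_mul.mp h).elim (by decide) ha)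
  obtain ⟨u, v, huv⟩ := hcop
  exact ⟨-(3 * b' * v), ⟨-(b' * v), by ring⟩, ⟨b' * u, by linear_combination (-3 * b') * huv⟩⟩

/-- Shear parameter for the triple-root cases: `3 b r ≡ −c (mod 27)` with `3 ∣ r`, for `3 ∤ b`,
`9 ∣ c` (Stoll–Cremona, proof of Prop. A.4: "`bt ≡ −c/9 mod 27`").
[cite: StollCremona2002, Prop. A.4 (proof)] -/
theorem exists_shear_c₃ {b c : ℤ} (hb : ¬ (3 : ℤ) ∣ b) (hc : (3 : ℤ) ^ 2 ∣ c) :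
    ∃ r : ℤ, (3 : ℤ) ∣ r ∧ (3 : ℤ) ^ 3 ∣ 3 * b * r + c := by
  obtain ⟨c', rfl⟩ := hc
  have hcop : IsCoprime (3 : ℤ) b := (Prime.coprime_iff_not_dvd Int.prime_three).mpr hb
  obtain ⟨u, v, huv⟩ := hcop
  exact ⟨-(3 * c' * v), ⟨-(c' * v), by ring⟩, ⟨c' * u, by linear_combination (-9 * c') * huv⟩⟩

/-- **Chase, quadruple root, `v(Q) = 0`, `p = 3`** (the case "handled in a similar way" in
Stoll–Cremona's proof of Prop. A.4): from `v(a,b,c,d,e) ≥ (0,2,1,1,1)`, `3 ∤ a`, `3⁵ ∣ I`,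
`3⁹ ∣ J` one gets in succession `v(c) ≥ 2`, `v(e) ≥ 3`, `v(d) ≥ 2`, `v(c) ≥ 3`, `v(e) ≥ 4`,
`v(d) ≥ 3`. [cite: StollCremona2002, Prop. A.4 (proof)] -/
theorem chase_quadruple₀₃ {a b c d e : ℤ} (ha : ¬ (3 : ℤ) ∣ a) (hb : (3 : ℤ) ^ 2 ∣ b)
    (hc : (3 : ℤ) ∣ c) (hd : (3 : ℤ) ∣ d) (he : (3 : ℤ) ∣ e)
    (hI : (3 : ℤ) ^ 5 ∣ 12 * a * e - 3 * b * d + c ^ 2)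
    (hJ : (3 : ℤ) ^ 9 ∣ 72 * a * c * e + 9 * b * c * d - 27 * a * d ^ 2 - 27 * e * b ^ 2 - 2 * c ^ 3) :
    (3 : ℤ) ^ 3 ∣ c ∧ (3 : ℤ) ^ 3 ∣ d ∧ (3 : ℤ) ^ 4 ∣ e := by
  obtain ⟨hP, h2, h4, h8, h3, h9, h27⟩ := three_prime_facts
  have h4a : ¬ (3 : ℤ) ∣ 4 * a := fun h ↦ (hP.dvd_mul.mp h).elim h4 ha
  set Iₑ := 12 * a * e - 3 * b * d + c ^ 2 with hIₑ
  set Jₑ := 72 * a * c * e + 9 * b * c * d - 27 * a * d ^ 2 - 27 * e * b ^ 2 - 2 * c ^ 3 with hJₑ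
  have eI : (3 : ℤ) ^ 1 * (4 * a * e) = Iₑ + 1 * b * 3 * d + (-1) * c ^ 2 := by rw [hIₑ]; ring
  have eJd : (3 : ℤ) ^ 3 * (a * d ^ 2) = 8 * a * 9 * c * e + 1 * 9 * b * c * d + (-1) * 27 * e * b ^ 2 +
      (-2) * c ^ 3 + (-1) * Jₑ := by rw [hJₑ]; ring
  have eJc : 2 * c ^ 3 = 8 * a * 9 * c * e + 1 * 9 * b * c * d + (-a) * 27 * d ^ 2 +
      (-1) * 27 * e * b ^ 2 + (-1) * Jₑ := by rw [hJₑ]; ring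
  have hc1 : (3 : ℤ) ^ 1 ∣ c := by rwa [pow_one]
  have hd1 : (3 : ℤ) ^ 1 ∣ d := by rwa [pow_one]
  have he1 : (3 : ℤ) ^ 1 ∣ e := by rwa [pow_one]
  -- `v(c) ≥ 2`
  have hc2 : (3 : ℤ) ^ 2 ∣ c := by
    refine sq_dvd_of_pow_four_dvd_cube hP (hP.pow_dvd_of_dvd_mul_left 4 h2 ?_)
    rw [eJc]
    refine dvd_add (dvd_add (dvd_add (dvd_add ?_ ?_) ?_) ?_) (pow_dvd_of_le (hJ.mul_left _) (by norm_num))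
    · exact pow_dvd_of_le (pow_dvd_mul₃ h9 hc1 he1 (8 * a)) (by norm_num)
    · exact pow_dvd_of_le (pow_dvd_mul₄ h9 hb hc1 hd1 1) (by norm_num)
    · exact pow_dvd_of_le (pow_dvd_mul₂ h27 (pow_dvd_sq_of_dvd hd1) (-a)) (by norm_num)
    · exact pow_dvd_of_le (pow_dvd_mul₃ h27 he1 (pow_dvd_sq_of_dvd hb) (-1)) (by norm_num)
  -- `v(e) ≥ 3`
  have he3 : (3 : ℤ) ^ 3 ∣ e := by
    refine hP.pow_dvd_of_dvd_mul_left 3 h4a ?_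
    have h : (3 : ℤ) ^ 4 ∣ (3 : ℤ) ^ 1 * (4 * a * e) := by
      rw [eI]
      refine dvd_add (dvd_add (pow_dvd_of_le hI (by norm_num)) ?_) ?_
      · exact pow_dvd_of_le (pow_dvd_mul₃ hb h3 hd1 1) (by norm_num)
      · exact pow_dvd_of_le ((pow_dvd_sq_of_dvd hc2).mul_left (-1)) (by norm_num)
    rw [show (4 : ℕ) = 1 + 3 from rfl, pow_add] at h
    exact (mul_dvd_mul_iff_left (by norm_num)).mp h
  -- `v(d) ≥ 2`
  have hd2 : (3 : ℤ) ^ 2 ∣ d := by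
    refine pow_dvd_of_sq_odd hP (k := 1) (hP.pow_dvd_of_dvd_mul_left 3 ha ?_)
    have h : (3 : ℤ) ^ 6 ∣ (3 : ℤ) ^ 3 * (a * d ^ 2) := by
      rw [eJd]
      refine dvd_add (dvd_add (dvd_add (dvd_add ?_ ?_) ?_) ?_) (pow_dvd_of_le (hJ.mul_left _) (by norm_num))
      · exact pow_dvd_of_le (pow_dvd_mul₃ h9 hc2 he3 (8 * a)) (by norm_num)
      · exact pow_dvd_of_le (pow_dvd_mul₄ h9 hb hc2 hd1 1) (by norm_num)
      · exact pow_dvd_of_le (pow_dvd_mul₃ h27 he3 (pow_dvd_sq_of_dvd hb) (-1)) (by norm_num)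
      · exact pow_dvd_of_le ((pow_dvd_cube_of_dvd hc2).mul_left (-2)) (by norm_num)
    rw [show (6 : ℕ) = 3 + 3 from rfl, pow_add] at h
    exact (mul_dvd_mul_iff_left (by norm_num)).mp h
  -- `v(c) ≥ 3`
  have hc3 : (3 : ℤ) ^ 3 ∣ c := by
    refine pow_dvd_of_cube_succ hP (k := 2) (hP.pow_dvd_of_dvd_mul_left 7 h2 ?_)
    rw [eJc]
    refine dvd_add (dvd_add (dvd_add (dvd_add ?_ ?_) ?_) ?_) (pow_dvd_of_le (hJ.mul_left _) (by norm_num))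
    · exact pow_dvd_of_le (pow_dvd_mul₃ h9 hc2 he3 (8 * a)) (by norm_num)
    · exact pow_dvd_of_le (pow_dvd_mul₄ h9 hb hc2 hd2 1) (by norm_num)
    · exact pow_dvd_of_le (pow_dvd_mul₂ h27 (pow_dvd_sq_of_dvd hd2) (-a)) (by norm_num)
    · exact pow_dvd_of_le (pow_dvd_mul₃ h27 he3 (pow_dvd_sq_of_dvd hb) (-1)) (by norm_num)
  -- `v(e) ≥ 4`
  have he4 : (3 : ℤ) ^ 4 ∣ e := by
    refine hP.pow_dvd_of_dvd_mul_left 4 h4a ?_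
    have h : (3 : ℤ) ^ 5 ∣ (3 : ℤ) ^ 1 * (4 * a * e) := by
      rw [eI]
      refine dvd_add (dvd_add hI ?_) ?_
      · exact pow_dvd_of_le (pow_dvd_mul₃ hb h3 hd2 1) (by norm_num)
      · exact pow_dvd_of_le ((pow_dvd_sq_of_dvd hc3).mul_left (-1)) (by norm_num)
    rw [show (5 : ℕ) = 1 + 4 from rfl, pow_add] at h
    exact (mul_dvd_mul_iff_left (by norm_num)).mp h
  -- `v(d) ≥ 3`
  have hd3 : (3 : ℤ) ^ 3 ∣ d := by
    refine pow_dvd_of_sq_even (k := 3) (hP.pow_dvd_of_dvd_mul_left 6 ha ?_)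
    have h : (3 : ℤ) ^ 9 ∣ (3 : ℤ) ^ 3 * (a * d ^ 2) := by
      rw [eJd]
      refine dvd_add (dvd_add (dvd_add (dvd_add ?_ ?_) ?_) ?_) (hJ.mul_left _)
      · exact pow_dvd_of_le (pow_dvd_mul₃ h9 hc3 he4 (8 * a)) (by norm_num)
      · exact pow_dvd_of_le (pow_dvd_mul₄ h9 hb hc3 hd2 1) (by norm_num)
      · exact pow_dvd_of_le (pow_dvd_mul₃ h27 he4 (pow_dvd_sq_of_dvd hb) (-1)) (by norm_num)
      · exact pow_dvd_of_le ((pow_dvd_cube_of_dvd hc3).mul_left (-2)) (by norm_num)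
    rw [show (9 : ℕ) = 3 + 6 from rfl, pow_add] at h
    exact (mul_dvd_mul_iff_left (by norm_num)).mp h
  exact ⟨hc3, hd3, he4⟩

/-- **Chase, triple root, `v(Q) = 0`, `p = 3`, before the shear** (Stoll–Cremona, proof of
Prop. A.4: "`v(J) ≥ 6` implies that `v(c) ≥ 2` and `v(e) ≥ 2`; then `v(I) ≥ 4` implies that
`v(d) ≥ 3`, and then `v(J) ≥ 6` implies that `v(e) ≥ 3`"). [cite: StollCremona2002, Prop. A.4 (proof)] -/
theorem chase_triple₀₃ {a b c d e : ℤ} (ha : (3 : ℤ) ∣ a) (hb : ¬ (3 : ℤ) ∣ b)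
    (hc : (3 : ℤ) ∣ c) (hd : (3 : ℤ) ∣ d) (he : (3 : ℤ) ∣ e)
    (hI : (3 : ℤ) ^ 4 ∣ 12 * a * e - 3 * b * d + c ^ 2)
    (hJ : (3 : ℤ) ^ 6 ∣ 72 * a * c * e + 9 * b * c * d - 27 * a * d ^ 2 - 27 * e * b ^ 2 - 2 * c ^ 3) :
    (3 : ℤ) ^ 2 ∣ c ∧ (3 : ℤ) ^ 3 ∣ d ∧ (3 : ℤ) ^ 3 ∣ e := by
  obtain ⟨hP, h2, -, h8, h3, h9, h27⟩ := three_prime_facts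
  have hb2 : ¬ (3 : ℤ) ∣ b ^ 2 := fun h ↦ hb (hP.dvd_of_dvd_pow h)
  set Iₑ := 12 * a * e - 3 * b * d + c ^ 2 with hIₑ
  set Jₑ := 72 * a * c * e + 9 * b * c * d - 27 * a * d ^ 2 - 27 * e * b ^ 2 - 2 * c ^ 3 with hJₑ
  have eI' : (3 : ℤ) ^ 1 * (b * d) = 4 * 3 * a * e + c ^ 2 + (-1) * Iₑ := by rw [hIₑ]; ring
  have eJe : (3 : ℤ) ^ 3 * (b ^ 2 * e) = 8 * a * 9 * c * e + b * 9 * c * d + (-1) * 27 * a * d ^ 2 +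
      (-2) * c ^ 3 + (-1) * Jₑ := by rw [hJₑ]; ring
  have eJc : 2 * c ^ 3 = 8 * a * 9 * c * e + b * 9 * c * d + (-a) * 27 * d ^ 2 +
      (-(b ^ 2)) * 27 * e + (-1) * Jₑ := by rw [hJₑ]; ring
  have ha1 : (3 : ℤ) ^ 1 ∣ a := by rwa [pow_one]
  have hc1 : (3 : ℤ) ^ 1 ∣ c := by rwa [pow_one]
  have hd1 : (3 : ℤ) ^ 1 ∣ d := by rwa [pow_one]
  have he1 : (3 : ℤ) ^ 1 ∣ e := by rwa [pow_one]
  -- `v(c) ≥ 2`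
  have hc2 : (3 : ℤ) ^ 2 ∣ c := by
    refine sq_dvd_of_pow_four_dvd_cube hP (hP.pow_dvd_of_dvd_mul_left 4 h2 ?_)
    rw [eJc]
    refine dvd_add (dvd_add (dvd_add (dvd_add ?_ ?_) ?_) ?_) (pow_dvd_of_le (hJ.mul_left _) (by norm_num))
    · exact pow_dvd_of_le (pow_dvd_mul₃ h9 hc1 he1 (8 * a)) (by norm_num)
    · exact pow_dvd_of_le (pow_dvd_mul₃ h9 hc1 hd1 b) (by norm_num)
    · exact pow_dvd_of_le (pow_dvd_mul₂ h27 (pow_dvd_sq_of_dvd hd1) (-a)) (by norm_num)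
    · exact pow_dvd_of_le (pow_dvd_mul₂ h27 he1 (-(b ^ 2))) (by norm_num)
  -- `v(e) ≥ 2`
  have he2 : (3 : ℤ) ^ 2 ∣ e := by
    refine hP.pow_dvd_of_dvd_mul_left 2 hb2 ?_
    have h : (3 : ℤ) ^ 5 ∣ (3 : ℤ) ^ 3 * (b ^ 2 * e) := by
      rw [eJe]
      refine dvd_add (dvd_add (dvd_add (dvd_add ?_ ?_) ?_) ?_) (pow_dvd_of_le (hJ.mul_left _) (by norm_num))
      · exact pow_dvd_of_le (pow_dvd_mul₄ ha1 h9 hc2 he1 8) (by norm_num)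
      · exact pow_dvd_of_le (pow_dvd_mul₃ h9 hc2 hd1 b) (by norm_num)
      · exact pow_dvd_of_le (pow_dvd_mul₃ h27 ha1 (pow_dvd_sq_of_dvd hd1) (-1)) (by norm_num)
      · exact pow_dvd_of_le ((pow_dvd_cube_of_dvd hc2).mul_left (-2)) (by norm_num)
    rw [show (5 : ℕ) = 3 + 2 from rfl, pow_add] at h
    exact (mul_dvd_mul_iff_left (by norm_num)).mp h
  -- `v(d) ≥ 3`
  have hd3 : (3 : ℤ) ^ 3 ∣ d := by
    refine hP.pow_dvd_of_dvd_mul_left 3 hb ?_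
    have h : (3 : ℤ) ^ 4 ∣ (3 : ℤ) ^ 1 * (b * d) := by
      rw [eI']
      refine dvd_add (dvd_add ?_ ?_) (hI.mul_left _)
      · exact pow_dvd_of_le (pow_dvd_mul₃ h3 ha1 he2 4) (by norm_num)
      · exact pow_dvd_of_le (pow_dvd_sq_of_dvd hc2) (by norm_num)
    rw [show (4 : ℕ) = 1 + 3 from rfl, pow_add] at h
    exact (mul_dvd_mul_iff_left (by norm_num)).mp h
  -- `v(e) ≥ 3`
  have he3 : (3 : ℤ) ^ 3 ∣ e := by
    refine hP.pow_dvd_of_dvd_mul_left 3 hb2 ?_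
    have h : (3 : ℤ) ^ 6 ∣ (3 : ℤ) ^ 3 * (b ^ 2 * e) := by
      rw [eJe]
      refine dvd_add (dvd_add (dvd_add (dvd_add ?_ ?_) ?_) ?_) (hJ.mul_left _)
      · exact pow_dvd_of_le (pow_dvd_mul₄ ha1 h9 hc2 he2 8) (by norm_num)
      · exact pow_dvd_of_le (pow_dvd_mul₃ h9 hc2 hd3 b) (by norm_num)
      · exact pow_dvd_of_le (pow_dvd_mul₃ h27 ha1 (pow_dvd_sq_of_dvd hd3) (-1)) (by norm_num)
      · exact pow_dvd_of_le ((pow_dvd_cube_of_dvd hc2).mul_left (-2)) (by norm_num)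
    rw [show (6 : ℕ) = 3 + 3 from rfl, pow_add] at h
    exact (mul_dvd_mul_iff_left (by norm_num)).mp h
  exact ⟨hc2, hd3, he3⟩

/-- **Chase, triple root, `v(Q) = 0`, `p = 3`, after the shear** (Stoll–Cremona, proof of
Prop. A.4: with `v(c) ≥ 3`, "if `v(I) ≥ 5`, we then see that `v(d) ≥ 4`, and then `v(J) ≥ 9`
implies that `v(e) ≥ 6`"). [cite: StollCremona2002, Prop. A.4 (proof)] -/
theorem chase_triple₀₃' {a b c d e : ℤ} (ha : (3 : ℤ) ∣ a) (hb : ¬ (3 : ℤ) ∣ b)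
    (hc : (3 : ℤ) ^ 3 ∣ c) (_hd : (3 : ℤ) ^ 3 ∣ d) (he : (3 : ℤ) ^ 3 ∣ e)
    (hI : (3 : ℤ) ^ 5 ∣ 12 * a * e - 3 * b * d + c ^ 2)
    (hJ : (3 : ℤ) ^ 9 ∣ 72 * a * c * e + 9 * b * c * d - 27 * a * d ^ 2 - 27 * e * b ^ 2 - 2 * c ^ 3) :
    (3 : ℤ) ^ 4 ∣ d ∧ (3 : ℤ) ^ 6 ∣ e := by
  obtain ⟨hP, -, -, -, h3, h9, h27⟩ := three_prime_facts
  have hb2 : ¬ (3 : ℤ) ∣ b ^ 2 := fun h ↦ hb (hP.dvd_of_dvd_pow h)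
  set Iₑ := 12 * a * e - 3 * b * d + c ^ 2 with hIₑ
  set Jₑ := 72 * a * c * e + 9 * b * c * d - 27 * a * d ^ 2 - 27 * e * b ^ 2 - 2 * c ^ 3 with hJₑ
  have eI' : (3 : ℤ) ^ 1 * (b * d) = 4 * 3 * a * e + c ^ 2 + (-1) * Iₑ := by rw [hIₑ]; ring
  have eJe : (3 : ℤ) ^ 3 * (b ^ 2 * e) = 8 * a * 9 * c * e + b * 9 * c * d + (-1) * 27 * a * d ^ 2 +
      (-2) * c ^ 3 + (-1) * Jₑ := by rw [hJₑ]; ring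
  have ha1 : (3 : ℤ) ^ 1 ∣ a := by rwa [pow_one]
  have hd4 : (3 : ℤ) ^ 4 ∣ d := by
    refine hP.pow_dvd_of_dvd_mul_left 4 hb ?_
    have h : (3 : ℤ) ^ 5 ∣ (3 : ℤ) ^ 1 * (b * d) := by
      rw [eI']
      refine dvd_add (dvd_add ?_ ?_) (hI.mul_left _)
      · exact pow_dvd_of_le (pow_dvd_mul₃ h3 ha1 he 4) (by norm_num)
      · exact pow_dvd_of_le (pow_dvd_sq_of_dvd hc) (by norm_num)
    rw [show (5 : ℕ) = 1 + 4 from rfl, pow_add] at h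
    exact (mul_dvd_mul_iff_left (by norm_num)).mp h
  have he6 : (3 : ℤ) ^ 6 ∣ e := by
    refine hP.pow_dvd_of_dvd_mul_left 6 hb2 ?_
    have h : (3 : ℤ) ^ 9 ∣ (3 : ℤ) ^ 3 * (b ^ 2 * e) := by
      rw [eJe]
      refine dvd_add (dvd_add (dvd_add (dvd_add ?_ ?_) ?_) ?_) (hJ.mul_left _)
      · exact pow_dvd_of_le (pow_dvd_mul₄ ha1 h9 hc he 8) (by norm_num)
      · exact pow_dvd_of_le (pow_dvd_mul₃ h9 hc hd4 b) (by norm_num)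
      · exact pow_dvd_of_le (pow_dvd_mul₃ h27 ha1 (pow_dvd_sq_of_dvd hd4) (-1)) (by norm_num)
      · exact pow_dvd_of_le ((pow_dvd_cube_of_dvd hc).mul_left (-2)) (by norm_num)
    rw [show (9 : ℕ) = 3 + 6 from rfl, pow_add] at h
    exact (mul_dvd_mul_iff_left (by norm_num)).mp h
  exact ⟨hd4, he6⟩

/-- **Chase, triple root, `v(Q) = 1`, `p = 3`** (Stoll–Cremona, proof of Prop. A.4: with
`v(a) ≥ 2`, `v(b) = 1`, `v(c), v(d), v(e) ≥ 2`, "we obtain in succession `v(c) ≥ 3`, `v(d) ≥ 3`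
and finally `v(e) ≥ 4`"). [cite: StollCremona2002, Prop. A.4 (proof)] -/
theorem chase_triple₁₃ {a b b₁ c d e : ℤ} (ha : (3 : ℤ) ^ 2 ∣ a) (hb : b = 3 * b₁)
    (hb₁ : ¬ (3 : ℤ) ∣ b₁) (hc : (3 : ℤ) ^ 2 ∣ c) (hd : (3 : ℤ) ^ 2 ∣ d) (he : (3 : ℤ) ^ 2 ∣ e)
    (hI : (3 : ℤ) ^ 5 ∣ 12 * a * e - 3 * b * d + c ^ 2)
    (hJ : (3 : ℤ) ^ 9 ∣ 72 * a * c * e + 9 * b * c * d - 27 * a * d ^ 2 - 27 * e * b ^ 2 - 2 * c ^ 3) :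
    (3 : ℤ) ^ 3 ∣ d ∧ (3 : ℤ) ^ 4 ∣ e := by
  obtain ⟨hP, h2, -, -, h3, h9, h27⟩ := three_prime_facts
  have hb₁2 : ¬ (3 : ℤ) ∣ b₁ ^ 2 := fun h ↦ hb₁ (hP.dvd_of_dvd_pow h)
  have hb1 : (3 : ℤ) ^ 1 ∣ b := ⟨b₁, by rw [pow_one, hb]⟩
  set Iₑ := 12 * a * e - 3 * b * d + c ^ 2 with hIₑ
  set Jₑ := 72 * a * c * e + 9 * b * c * d - 27 * a * d ^ 2 - 27 * e * b ^ 2 - 2 * c ^ 3 with hJₑ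
  have eI' : (3 : ℤ) ^ 2 * (b₁ * d) = 4 * 3 * a * e + c ^ 2 + (-1) * Iₑ := by rw [hIₑ, hb]; ring
  have eJe : (3 : ℤ) ^ 5 * (b₁ ^ 2 * e) = 8 * a * 9 * c * e + 1 * 9 * b * c * d + (-1) * 27 * a * d ^ 2 +
      (-2) * c ^ 3 + (-1) * Jₑ := by rw [hJₑ, hb]; ring
  have eJc : 2 * c ^ 3 = 8 * a * 9 * c * e + 1 * 9 * b * c * d + (-1) * 27 * a * d ^ 2 +
      (-1) * 27 * e * b ^ 2 + (-1) * Jₑ := by rw [hJₑ]; ring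
  -- `v(c) ≥ 3`
  have hc3 : (3 : ℤ) ^ 3 ∣ c := by
    refine pow_dvd_of_cube_succ hP (k := 2) (hP.pow_dvd_of_dvd_mul_left 7 h2 ?_)
    rw [eJc]
    refine dvd_add (dvd_add (dvd_add (dvd_add ?_ ?_) ?_) ?_) (pow_dvd_of_le (hJ.mul_left _) (by norm_num))
    · exact pow_dvd_of_le (pow_dvd_mul₄ ha h9 hc he 8) (by norm_num)
    · exact pow_dvd_of_le (pow_dvd_mul₄ h9 hb1 hc hd 1) (by norm_num)
    · exact pow_dvd_of_le (pow_dvd_mul₃ h27 ha (pow_dvd_sq_of_dvd hd) (-1)) (by norm_num)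
    · exact pow_dvd_of_le (pow_dvd_mul₃ h27 he (pow_dvd_sq_of_dvd hb1) (-1)) (by norm_num)
  -- `v(d) ≥ 3`
  have hd3 : (3 : ℤ) ^ 3 ∣ d := by
    refine hP.pow_dvd_of_dvd_mul_left 3 hb₁ ?_
    have h : (3 : ℤ) ^ 5 ∣ (3 : ℤ) ^ 2 * (b₁ * d) := by
      rw [eI']
      refine dvd_add (dvd_add ?_ ?_) (hI.mul_left _)
      · exact pow_dvd_of_le (pow_dvd_mul₃ h3 ha he 4) (by norm_num)
      · exact pow_dvd_of_le (pow_dvd_sq_of_dvd hc3) (by norm_num)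
    rw [show (5 : ℕ) = 2 + 3 from rfl, pow_add] at h
    exact (mul_dvd_mul_iff_left (by norm_num)).mp h
  -- `v(e) ≥ 4`
  have he4 : (3 : ℤ) ^ 4 ∣ e := by
    refine hP.pow_dvd_of_dvd_mul_left 4 hb₁2 ?_
    have h : (3 : ℤ) ^ 9 ∣ (3 : ℤ) ^ 5 * (b₁ ^ 2 * e) := by
      rw [eJe]
      refine dvd_add (dvd_add (dvd_add (dvd_add ?_ ?_) ?_) ?_) (hJ.mul_left _)
      · exact pow_dvd_of_le (pow_dvd_mul₄ ha h9 hc3 he 8) (by norm_num)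
      · exact pow_dvd_of_le (pow_dvd_mul₄ h9 hb1 hc3 hd3 1) (by norm_num)
      · exact pow_dvd_of_le (pow_dvd_mul₃ h27 ha (pow_dvd_sq_of_dvd hd3) (-1)) (by norm_num)
      · exact pow_dvd_of_le ((pow_dvd_cube_of_dvd hc3).mul_left (-2)) (by norm_num)
    rw [show (9 : ℕ) = 5 + 4 from rfl, pow_add] at h
    exact (mul_dvd_mul_iff_left (by norm_num)).mp h
  exact ⟨hd3, he4⟩

/-- **Chase, quadruple root, `v(Q) = 1`, `p = 3`** (Stoll–Cremona, proof of Prop. A.4: with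
`v(a) = 1`, `v(b), v(c), v(d), v(e) ≥ 2`, "we obtain in succession `v(c) ≥ 3`, `v(e) ≥ 3`,
`v(d) ≥ 3`"). [cite: StollCremona2002, Prop. A.4 (proof)] -/
theorem chase_quadruple₁₃ {a a₁ b c d e : ℤ} (ha : a = 3 * a₁) (ha₁ : ¬ (3 : ℤ) ∣ a₁)
    (hb : (3 : ℤ) ^ 2 ∣ b) (hc : (3 : ℤ) ^ 2 ∣ c) (hd : (3 : ℤ) ^ 2 ∣ d) (he : (3 : ℤ) ^ 2 ∣ e)
    (hI : (3 : ℤ) ^ 5 ∣ 12 * a * e - 3 * b * d + c ^ 2)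
    (hJ : (3 : ℤ) ^ 9 ∣ 72 * a * c * e + 9 * b * c * d - 27 * a * d ^ 2 - 27 * e * b ^ 2 - 2 * c ^ 3) :
    (3 : ℤ) ^ 3 ∣ c ∧ (3 : ℤ) ^ 3 ∣ d ∧ (3 : ℤ) ^ 3 ∣ e := by
  obtain ⟨hP, h2, h4, -, h3, h9, h27⟩ := three_prime_facts
  have h4a : ¬ (3 : ℤ) ∣ 4 * a₁ := fun h ↦ (hP.dvd_mul.mp h).elim h4 ha₁
  have ha1 : (3 : ℤ) ^ 1 ∣ a := ⟨a₁, by rw [pow_one, ha]⟩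
  set Iₑ := 12 * a * e - 3 * b * d + c ^ 2 with hIₑ
  set Jₑ := 72 * a * c * e + 9 * b * c * d - 27 * a * d ^ 2 - 27 * e * b ^ 2 - 2 * c ^ 3 with hJₑ
  have eI : (3 : ℤ) ^ 2 * (4 * a₁ * e) = Iₑ + 1 * b * 3 * d + (-1) * c ^ 2 := by rw [hIₑ, ha]; ring
  have eJd : (3 : ℤ) ^ 4 * (a₁ * d ^ 2) = 8 * a * 9 * c * e + 1 * 9 * b * c * d + (-1) * 27 * e * b ^ 2 +
      (-2) * c ^ 3 + (-1) * Jₑ := by rw [hJₑ, ha]; ring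
  have eJc : 2 * c ^ 3 = 8 * a * 9 * c * e + 1 * 9 * b * c * d + (-1) * 27 * a * d ^ 2 +
      (-1) * 27 * e * b ^ 2 + (-1) * Jₑ := by rw [hJₑ]; ring
  -- `v(c) ≥ 3`
  have hc3 : (3 : ℤ) ^ 3 ∣ c := by
    refine pow_dvd_of_cube_succ hP (k := 2) (hP.pow_dvd_of_dvd_mul_left 7 h2 ?_)
    rw [eJc]
    refine dvd_add (dvd_add (dvd_add (dvd_add ?_ ?_) ?_) ?_) (pow_dvd_of_le (hJ.mul_left _) (by norm_num))
    · exact pow_dvd_of_le (pow_dvd_mul₄ ha1 h9 hc he 8) (by norm_num)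
    · exact pow_dvd_of_le (pow_dvd_mul₄ h9 hb hc hd 1) (by norm_num)
    · exact pow_dvd_of_le (pow_dvd_mul₃ h27 ha1 (pow_dvd_sq_of_dvd hd) (-1)) (by norm_num)
    · exact pow_dvd_of_le (pow_dvd_mul₃ h27 he (pow_dvd_sq_of_dvd hb) (-1)) (by norm_num)
  -- `v(e) ≥ 3`
  have he3 : (3 : ℤ) ^ 3 ∣ e := by
    refine hP.pow_dvd_of_dvd_mul_left 3 h4a ?_
    have h : (3 : ℤ) ^ 5 ∣ (3 : ℤ) ^ 2 * (4 * a₁ * e) := by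
      rw [eI]
      refine dvd_add (dvd_add hI ?_) ?_
      · exact pow_dvd_of_le (pow_dvd_mul₃ hb h3 hd 1) (by norm_num)
      · exact pow_dvd_of_le ((pow_dvd_sq_of_dvd hc3).mul_left (-1)) (by norm_num)
    rw [show (5 : ℕ) = 2 + 3 from rfl, pow_add] at h
    exact (mul_dvd_mul_iff_left (by norm_num)).mp h
  -- `v(d) ≥ 3`
  have hd3 : (3 : ℤ) ^ 3 ∣ d := by
    refine pow_dvd_of_sq_odd hP (k := 2) (hP.pow_dvd_of_dvd_mul_left 5 ha₁ ?_)
    have h : (3 : ℤ) ^ 9 ∣ (3 : ℤ) ^ 4 * (a₁ * d ^ 2) := by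
      rw [eJd]
      refine dvd_add (dvd_add (dvd_add (dvd_add ?_ ?_) ?_) ?_) (hJ.mul_left _)
      · exact pow_dvd_of_le (pow_dvd_mul₄ ha1 h9 hc3 he3 8) (by norm_num)
      · exact pow_dvd_of_le (pow_dvd_mul₄ h9 hb hc3 hd 1) (by norm_num)
      · exact pow_dvd_of_le (pow_dvd_mul₃ h27 he3 (pow_dvd_sq_of_dvd hb) (-1)) (by norm_num)
      · exact pow_dvd_of_le ((pow_dvd_cube_of_dvd hc3).mul_left (-2)) (by norm_num)
    rw [show (9 : ℕ) = 4 + 5 from rfl, pow_add] at h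
    exact (mul_dvd_mul_iff_left (by norm_num)).mp h
  exact ⟨hc3, hd3, he3⟩

end Three

/-! ## §E₃ Assembly: Stoll–Cremona Prop. A.4 (sufficiency, `v(I) ≥ 5`, `v(J) ≥ 9`) =
Birch–Swinnerton-Dyer Lemma 4 -/

section Assembly

/-- **Birch–Swinnerton-Dyer, Lemma 4 = Bhargava–Shankar, Lemma 5.4 = Stoll–Cremona, Prop. A.4
(sufficiency), proved**: an integral binary quartic form `f` with `3⁵ ∣ I(f)`, `3⁹ ∣ J(f)` and
`z² = f(x, y)` soluble over `ℚ₃` is `ℚ`-equivalent to an integral form with invariants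
`3⁻⁴ I(f)`, `3⁻⁶ J(f)` (`Literature.NumberTheory.EllipticCurves.bsd_minimisation_three`).
Proof as in Stoll–Cremona, p. 239 (see the module docstring for the case analysis).
[cite: StollCremona2002, Prop. A.4 (proof)] -/
theorem bsd_minimisation_three_holds : bsd_minimisation_three := by
  intro f hI hJ hsol
  have hP : Prime (3 : ℤ) := Int.prime_three
  have hP0 : (3 : ℤ) ≠ 0 := by norm_num
  haveI : Fact (Nat.Prime 3) := ⟨Nat.prime_three⟩
  -- unimodular integral substitutions: equivalence, solubility, invariants
  have kequiv_of_det : ∀ (g : BinaryQuartic ℤ) (M : Matrix (Fin 2) (Fin 2) ℤ), M.det = 1 →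
      KEquiv (g.map (Int.castRingHom ℚ)) ((g.subst M).map (Int.castRingHom ℚ)) :=
    fun g M hM ↦ (GL2ZEquiv.pgl2Equiv_map ⟨M, by rw [hM]; exact isUnit_one, rfl⟩).kEquiv
  have sol_of_det : ∀ (g : BinaryQuartic ℤ) (M : Matrix (Fin 2) (Fin 2) ℤ), M.det = 1 →
      (g.map (Int.castRingHom ℚ_[3])).IsSoluble →
        ((g.subst M).map (Int.castRingHom ℚ_[3])).IsSoluble := by
    intro g M hM hs
    rw [map_subst, isSoluble_subst_iff]
    · exact hs
    · rw [det_map_ringHom, hM, map_one]; exact one_ne_zero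
  have I_of_det : ∀ (g : BinaryQuartic ℤ) (M : Matrix (Fin 2) (Fin 2) ℤ), M.det = 1 →
      (g.subst M).I = g.I := fun g M hM ↦ by rw [I_subst, hM, one_pow, one_mul]
  have J_of_det : ∀ (g : BinaryQuartic ℤ) (M : Matrix (Fin 2) (Fin 2) ℤ), M.det = 1 →
      (g.subst M).J = g.J := fun g M hM ↦ by rw [J_subst, hM, one_pow, one_mul]
  -- valuations of the coefficients after a shear by `r`, `3 ∣ r`
  have shearv : ∀ (h : BinaryQuartic ℤ) (r : ℤ), (3 : ℤ) ∣ r →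
      h.subst !![1, 0; r, 1] = ⟨h.a, 4 * h.a * r + h.b, 6 * h.a * r ^ 2 + 3 * h.b * r + h.c,
        4 * h.a * r ^ 3 + 3 * h.b * r ^ 2 + 2 * h.c * r + h.d,
        h.a * r ^ 4 + h.b * r ^ 3 + h.c * r ^ 2 + h.d * r + h.e⟩ :=
    fun h r _ ↦ subst_lowerShear h r
  by_cases h2all : (3 : ℤ) ^ 2 ∣ f.a ∧ (3 : ℤ) ^ 2 ∣ f.b ∧ (3 : ℤ) ^ 2 ∣ f.c ∧
      (3 : ℤ) ^ 2 ∣ f.d ∧ (3 : ℤ) ^ 2 ∣ f.e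
  · -- `v(Q) ≥ 2`: Lemma A.1(3)
    obtain ⟨ha, hb, hc, hd, he⟩ := h2all
    exact reduce_three hP0 f ha hb hc hd he
  by_cases h1all : (3 : ℤ) ∣ f.a ∧ (3 : ℤ) ∣ f.b ∧ (3 : ℤ) ∣ f.c ∧ (3 : ℤ) ∣ f.d ∧ (3 : ℤ) ∣ f.e
  · -- `v(Q) = 1`: `f = 3 f₀`, `v(I₀) ≥ 3`, `v(J₀) ≥ 6`
    obtain ⟨⟨a₀, ha₀⟩, ⟨b₀, hb₀⟩, ⟨c₀, hc₀⟩, ⟨d₀, hd₀⟩, ⟨e₀, he₀⟩⟩ := h1all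
    have hff₀ : f = (3 : ℤ) • (⟨a₀, b₀, c₀, d₀, e₀⟩ : BinaryQuartic ℤ) := by
      ext
      · exact ha₀
      · exact hb₀
      · exact hc₀
      · exact hd₀
      · exact he₀
    have hf₀v : ¬ ((3 : ℤ) ∣ a₀ ∧ (3 : ℤ) ∣ b₀ ∧ (3 : ℤ) ∣ c₀ ∧ (3 : ℤ) ∣ d₀ ∧ (3 : ℤ) ∣ e₀) := by
      rintro ⟨h₁, h₂, h₃, h₄, h₅⟩
      apply h2all
      rw [ha₀, hb₀, hc₀, hd₀, he₀, sq]
      exact ⟨mul_dvd_mul_left _ h₁, mul_dvd_mul_left _ h₂, mul_dvd_mul_left _ h₃,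
        mul_dvd_mul_left _ h₄, mul_dvd_mul_left _ h₅⟩
    have hI₀ : (3 : ℤ) ^ 3 ∣ (⟨a₀, b₀, c₀, d₀, e₀⟩ : BinaryQuartic ℤ).I := by
      have h5 : (3 : ℤ) ^ 2 * (3 : ℤ) ^ 3 ∣ (3 : ℤ) ^ 2 * (⟨a₀, b₀, c₀, d₀, e₀⟩ : BinaryQuartic ℤ).I := by
        have := hI
        rw [hff₀, I_smul] at this
        calc (3 : ℤ) ^ 2 * (3 : ℤ) ^ 3 = (3 : ℤ) ^ 5 := by ring
          _ ∣ _ := this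
      exact (mul_dvd_mul_iff_left (pow_ne_zero 2 hP0)).mp h5
    have hJ₀ : (3 : ℤ) ^ 6 ∣ (⟨a₀, b₀, c₀, d₀, e₀⟩ : BinaryQuartic ℤ).J := by
      have h9 : (3 : ℤ) ^ 3 * (3 : ℤ) ^ 6 ∣ (3 : ℤ) ^ 3 * (⟨a₀, b₀, c₀, d₀, e₀⟩ : BinaryQuartic ℤ).J := by
        have := hJ
        rw [hff₀, J_smul] at this
        calc (3 : ℤ) ^ 3 * (3 : ℤ) ^ 6 = (3 : ℤ) ^ 9 := by ring
          _ ∣ _ := this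
      exact (mul_dvd_mul_iff_left (pow_ne_zero 3 hP0)).mp h9
    obtain ⟨hc₀3, hdisc₀⟩ := three_dvd_c_and_disc (⟨a₀, b₀, c₀, d₀, e₀⟩ : BinaryQuartic ℤ)
      ((dvd_pow_self (3 : ℤ) (by norm_num : (3 : ℕ) ≠ 0)).trans hI₀) hI₀
      (pow_dvd_of_le hJ₀ (by norm_num))
    obtain ⟨M, hMdet, hshape⟩ := exists_sl2_shape₃ (⟨a₀, b₀, c₀, d₀, e₀⟩ : BinaryQuartic ℤ)
      hf₀v hc₀3 hdisc₀
    obtain ⟨h, hh⟩ : ∃ h : BinaryQuartic ℤ, (⟨a₀, b₀, c₀, d₀, e₀⟩ : BinaryQuartic ℤ).subst M = h :=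
      ⟨_, rfl⟩
    have hfM : f.subst M = (3 : ℤ) • h := by rw [hff₀, smul_subst, hh]
    rw [hh] at hshape
    obtain ⟨f₁, hf₁⟩ : ∃ f₁ : BinaryQuartic ℤ, f.subst M = f₁ := ⟨_, rfl⟩
    have hIf₁ : f₁.I = f.I := by rw [← hf₁, I_of_det f M hMdet]
    have hJf₁ : f₁.J = f.J := by rw [← hf₁, J_of_det f M hMdet]
    have hI₁ : (3 : ℤ) ^ 5 ∣ f₁.I := by rw [hIf₁]; exact hI
    have hJ₁ : (3 : ℤ) ^ 9 ∣ f₁.J := by rw [hJf₁]; exact hJ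
    have hK₁ : KEquiv (f.map (Int.castRingHom ℚ)) (f₁.map (Int.castRingHom ℚ)) := by
      rw [← hf₁]; exact kequiv_of_det f M hMdet
    have hsol₁ : (f₁.map (Int.castRingHom ℚ_[3])).IsSoluble := by
      rw [← hf₁]; exact sol_of_det f M hMdet hsol
    have hf₁' : f₁ = (3 : ℤ) • h := by rw [← hf₁, hfM]
    have e_a : f₁.a = 3 * h.a := by rw [hf₁', smul_a]
    have e_b : f₁.b = 3 * h.b := by rw [hf₁', smul_b]
    have e_c : f₁.c = 3 * h.c := by rw [hf₁', smul_c]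
    have e_d : f₁.d = 3 * h.d := by rw [hf₁', smul_d]
    have e_e : f₁.e = 3 * h.e := by rw [hf₁', smul_e]
    rcases hshape with ⟨ha, hb, hc, hd, he⟩ | ⟨ha, hb, hc, hd, he⟩
    · -- quadruple root, `v(Q) = 1`
      have hb₁ : (3 : ℤ) ^ 2 ∣ f₁.b := by rw [e_b, sq]; exact mul_dvd_mul_left _ hb
      have hc₁ : (3 : ℤ) ^ 2 ∣ f₁.c := by rw [e_c, sq]; exact mul_dvd_mul_left _ hc
      have hd₁ : (3 : ℤ) ^ 2 ∣ f₁.d := by rw [e_d, sq]; exact mul_dvd_mul_left _ hd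
      have he₁ : (3 : ℤ) ^ 2 ∣ f₁.e := by rw [e_e, sq]; exact mul_dvd_mul_left _ he
      obtain ⟨hc3, hd3, he3⟩ := chase_quadruple₁₃ e_a ha hb₁ hc₁ hd₁ he₁
        (by simpa only [I] using hI₁) (by simpa only [J] using hJ₁)
      have he4 : (3 : ℤ) ^ 4 ∣ f₁.e := by
        by_contra hne
        obtain ⟨e₃, he₃⟩ := he3
        have he₃' : ¬ (3 : ℤ) ∣ e₃ := fun h' ↦
          hne (by rw [he₃, show (4 : ℕ) = 3 + 1 from rfl, pow_succ]; exact mul_dvd_mul_left _ h')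
        exact not_isSoluble_of_valuations (p := 3) f₁ (a₀ := h.a) (e₀ := e₃)
          (by rw [e_a]; norm_num) (by exact_mod_cast ha) (by exact_mod_cast hb₁)
          (by exact_mod_cast hc₁) (by exact_mod_cast hd3) (by rw [he₃]; norm_num)
          (by exact_mod_cast he₃') hsol₁
      obtain ⟨f', hK, hI', hJ'⟩ :=
        reduce_one hP0 f₁ ((dvd_pow_self _ two_ne_zero).trans hb₁) hc₁ hd3 he4
      exact ⟨f', TwoCovering.kEquiv_trans hK₁ hK, by rw [hI', hIf₁], by rw [hJ', hJf₁]⟩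
    · -- triple root, `v(Q) = 1`
      have ha₂ : (3 : ℤ) ^ 2 ∣ f₁.a := by rw [e_a, sq]; exact mul_dvd_mul_left _ ha
      have hc₂ : (3 : ℤ) ^ 2 ∣ f₁.c := by rw [e_c, sq]; exact mul_dvd_mul_left _ hc
      have hd₂ : (3 : ℤ) ^ 2 ∣ f₁.d := by rw [e_d, sq]; exact mul_dvd_mul_left _ hd
      have he₂ : (3 : ℤ) ^ 2 ∣ f₁.e := by rw [e_e, sq]; exact mul_dvd_mul_left _ he
      obtain ⟨hd3, he4⟩ := chase_triple₁₃ ha₂ e_b hb hc₂ hd₂ he₂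
        (by simpa only [I] using hI₁) (by simpa only [J] using hJ₁)
      have hb₁ : (3 : ℤ) ∣ f₁.b := by rw [e_b]; exact dvd_mul_right _ _
      obtain ⟨f', hK, hI', hJ'⟩ := reduce_one hP0 f₁ hb₁ hc₂ hd3 he4
      exact ⟨f', TwoCovering.kEquiv_trans hK₁ hK, by rw [hI', hIf₁], by rw [hJ', hJf₁]⟩
  · -- `v(Q) = 0`
    obtain ⟨hc3, hdisc⟩ := three_dvd_c_and_disc f
      ((dvd_pow_self (3 : ℤ) (by norm_num : (5 : ℕ) ≠ 0)).trans hI)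
      (pow_dvd_of_le hI (by norm_num)) (pow_dvd_of_le hJ (by norm_num))
    obtain ⟨M, hMdet, hshape⟩ := exists_sl2_shape₃ f h1all hc3 hdisc
    obtain ⟨f₁, hf₁⟩ : ∃ f₁ : BinaryQuartic ℤ, f.subst M = f₁ := ⟨_, rfl⟩
    have hIf₁ : f₁.I = f.I := by rw [← hf₁, I_of_det f M hMdet]
    have hJf₁ : f₁.J = f.J := by rw [← hf₁, J_of_det f M hMdet]
    have hI₁ : (3 : ℤ) ^ 5 ∣ f₁.I := by rw [hIf₁]; exact hI
    have hJ₁ : (3 : ℤ) ^ 9 ∣ f₁.J := by rw [hJf₁]; exact hJ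
    have hK₁ : KEquiv (f.map (Int.castRingHom ℚ)) (f₁.map (Int.castRingHom ℚ)) := by
      rw [← hf₁]; exact kequiv_of_det f M hMdet
    rw [hf₁] at hshape
    rcases hshape with ⟨ha, hb, hc, hd, he⟩ | ⟨ha, hb, hc, hd, he⟩
    · -- quadruple root, `v(Q) = 0`: first improve `v(b) ≥ 2` by a shear
      obtain ⟨r, hr, hrb⟩ := exists_shear_b₃ ha hb
      have hLdet : (!![1, 0; r, 1] : Matrix (Fin 2) (Fin 2) ℤ).det = 1 := det_lowerShear r
      obtain ⟨f₂, hf₂⟩ : ∃ f₂ : BinaryQuartic ℤ, f₁.subst !![1, 0; r, 1] = f₂ := ⟨_, rfl⟩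
      have hf₂' := shearv f₁ r hr
      rw [hf₂] at hf₂'
      have hIf₂ : f₂.I = f.I := by rw [← hf₂, I_of_det f₁ _ hLdet, hIf₁]
      have hJf₂ : f₂.J = f.J := by rw [← hf₂, J_of_det f₁ _ hLdet, hJf₁]
      have hI₂ : (3 : ℤ) ^ 5 ∣ f₂.I := by rw [hIf₂]; exact hI
      have hJ₂ : (3 : ℤ) ^ 9 ∣ f₂.J := by rw [hJf₂]; exact hJ
      have hK₂ : KEquiv (f₁.map (Int.castRingHom ℚ)) (f₂.map (Int.castRingHom ℚ)) := by
        rw [← hf₂]; exact kequiv_of_det f₁ _ hLdet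
      have ha' : ¬ (3 : ℤ) ∣ f₂.a := by rw [hf₂']; exact ha
      have hb' : (3 : ℤ) ^ 2 ∣ f₂.b := by rw [hf₂']; exact hrb
      have hc' : (3 : ℤ) ∣ f₂.c := by
        rw [hf₂']
        show (3 : ℤ) ∣ 6 * f₁.a * r ^ 2 + 3 * f₁.b * r + f₁.c
        refine dvd_add (dvd_add ?_ ?_) hc
        · exact (dvd_pow hr two_ne_zero).mul_left _
        · exact hr.mul_left _
      have hd' : (3 : ℤ) ∣ f₂.d := by
        rw [hf₂']
        show (3 : ℤ) ∣ 4 * f₁.a * r ^ 3 + 3 * f₁.b * r ^ 2 + 2 * f₁.c * r + f₁.d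
        refine dvd_add (dvd_add (dvd_add ?_ ?_) ?_) hd
        · exact (dvd_pow hr three_ne_zero).mul_left _
        · exact (dvd_pow hr two_ne_zero).mul_left _
        · exact hr.mul_left _
      have he' : (3 : ℤ) ∣ f₂.e := by
        rw [hf₂']
        show (3 : ℤ) ∣ f₁.a * r ^ 4 + f₁.b * r ^ 3 + f₁.c * r ^ 2 + f₁.d * r + f₁.e
        refine dvd_add (dvd_add (dvd_add (dvd_add ?_ ?_) ?_) ?_) he
        · exact (dvd_pow hr four_ne_zero).mul_left _
        · exact (dvd_pow hr three_ne_zero).mul_left _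
        · exact (dvd_pow hr two_ne_zero).mul_left _
        · exact hr.mul_left _
      obtain ⟨hc3', hd3', he4'⟩ := chase_quadruple₀₃ ha' hb' hc' hd' he'
        (by simpa only [I] using hI₂) (by simpa only [J] using hJ₂)
      obtain ⟨f', hK, hI', hJ'⟩ := reduce_one hP0 f₂ ((dvd_pow_self _ two_ne_zero).trans hb')
        (pow_dvd_of_le hc3' (by norm_num)) hd3' he4'
      exact ⟨f', TwoCovering.kEquiv_trans hK₁ (TwoCovering.kEquiv_trans hK₂ hK),
        by rw [hI', hIf₂], by rw [hJ', hJf₂]⟩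
    · -- triple root, `v(Q) = 0`
      have hI₁' : (3 : ℤ) ^ 4 ∣ f₁.I := pow_dvd_of_le hI₁ (by norm_num)
      have hJ₁' : (3 : ℤ) ^ 6 ∣ f₁.J := pow_dvd_of_le hJ₁ (by norm_num)
      obtain ⟨hc2, hd3, he3⟩ := chase_triple₀₃ ha hb hc hd he
        (by simpa only [I] using hI₁') (by simpa only [J] using hJ₁')
      obtain ⟨r, hr, hrc⟩ := exists_shear_c₃ hb hc2
      have hLdet : (!![1, 0; r, 1] : Matrix (Fin 2) (Fin 2) ℤ).det = 1 := det_lowerShear r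
      obtain ⟨f₂, hf₂⟩ : ∃ f₂ : BinaryQuartic ℤ, f₁.subst !![1, 0; r, 1] = f₂ := ⟨_, rfl⟩
      have hf₂' := shearv f₁ r hr
      rw [hf₂] at hf₂'
      have hIf₂ : f₂.I = f.I := by rw [← hf₂, I_of_det f₁ _ hLdet, hIf₁]
      have hJf₂ : f₂.J = f.J := by rw [← hf₂, J_of_det f₁ _ hLdet, hJf₁]
      have hI₂ : (3 : ℤ) ^ 5 ∣ f₂.I := by rw [hIf₂]; exact hI
      have hJ₂ : (3 : ℤ) ^ 9 ∣ f₂.J := by rw [hJf₂]; exact hJ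
      have hK₂ : KEquiv (f₁.map (Int.castRingHom ℚ)) (f₂.map (Int.castRingHom ℚ)) := by
        rw [← hf₂]; exact kequiv_of_det f₁ _ hLdet
      have hr1 : (3 : ℤ) ^ 1 ∣ r := by rwa [pow_one]
      have ha1 : (3 : ℤ) ^ 1 ∣ f₁.a := by rwa [pow_one]
      have ha' : (3 : ℤ) ∣ f₂.a := by rw [hf₂']; exact ha
      have hb' : ¬ (3 : ℤ) ∣ f₂.b := by
        rw [hf₂']
        intro h'
        exact hb ((dvd_add_right (hr.mul_left (4 * f₁.a))).mp h')
      have hc' : (3 : ℤ) ^ 3 ∣ f₂.c := by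
        rw [hf₂']
        show (3 : ℤ) ^ 3 ∣ 6 * f₁.a * r ^ 2 + 3 * f₁.b * r + f₁.c
        rw [add_assoc]
        refine dvd_add ?_ hrc
        exact pow_dvd_of_le (pow_dvd_mul₂ ha1 (pow_dvd_sq_of_dvd hr1) 6) (by norm_num)
      have hd' : (3 : ℤ) ^ 3 ∣ f₂.d := by
        rw [hf₂']
        show (3 : ℤ) ^ 3 ∣ 4 * f₁.a * r ^ 3 + 3 * f₁.b * r ^ 2 + 2 * f₁.c * r + f₁.d
        refine dvd_add (dvd_add (dvd_add ?_ ?_) ?_) hd3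
        · exact pow_dvd_of_le (pow_dvd_mul₂ ha1 (pow_dvd_cube_of_dvd hr1) 4) (by norm_num)
        · have h33 : (3 : ℤ) * 3 ^ 2 ∣ 3 * f₁.b * r ^ 2 :=
            mul_dvd_mul (dvd_mul_right 3 f₁.b) (pow_dvd_pow_of_dvd hr 2)
          rwa [← pow_succ'] at h33
        · exact pow_dvd_of_le (pow_dvd_mul₂ hc2 hr1 2) (by norm_num)
      have he' : (3 : ℤ) ^ 3 ∣ f₂.e := by
        rw [hf₂']
        show (3 : ℤ) ^ 3 ∣ f₁.a * r ^ 4 + f₁.b * r ^ 3 + f₁.c * r ^ 2 + f₁.d * r + f₁.e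
        refine dvd_add (dvd_add (dvd_add (dvd_add ?_ ?_) ?_) ?_) he3
        · have : (3 : ℤ) ^ 4 ∣ r ^ 4 := pow_dvd_pow_of_dvd hr 4
          exact pow_dvd_of_le (this.mul_left _) (by norm_num)
        · exact (pow_dvd_pow_of_dvd hr 3).mul_left _
        · have h22 : (3 : ℤ) ^ 2 * 3 ^ 2 ∣ f₁.c * r ^ 2 := mul_dvd_mul hc2 (pow_dvd_pow_of_dvd hr 2)
          rw [← pow_add] at h22
          exact pow_dvd_of_le h22 (by norm_num)
        · have h31 : (3 : ℤ) ^ 3 * 3 ∣ f₁.d * r := mul_dvd_mul hd3 hr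
          rw [← pow_succ] at h31
          exact pow_dvd_of_le h31 (by norm_num)
      obtain ⟨hd4, he6⟩ := chase_triple₀₃' ha' hb' hc' hd' he'
        (by simpa only [I] using hI₂) (by simpa only [J] using hJ₂)
      obtain ⟨f', hK, hI', hJ'⟩ := reduce_two hP0 f₂ (pow_dvd_of_le hc' (by norm_num)) hd4 he6
      exact ⟨f', TwoCovering.kEquiv_trans hK₁ (TwoCovering.kEquiv_trans hK₂ hK),
        by rw [hI', hIf₂], by rw [hJ', hJf₂]⟩

end Assembly

end BinaryQuartic

/-- Re-export at the level of the named fact's namespace: **Bhargava–Shankar Lemma 5.4 /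
Birch–Swinnerton-Dyer Lemma 4 holds** (`bsd_minimisation_three`).
[cite: BhargavaShankarAnnals2015, Lemma 5.4 (arXiv:1006.1002v2 numbering)] -/
theorem bsd_minimisation_three_holds : bsd_minimisation_three :=
  BinaryQuartic.bsd_minimisation_three_holds

/-! ## The current frontier of the decomposition of `averageRankLE_three_halves`

With Lemmas 5.3 and 5.4 discharged (`bsd_minimisation_prime_five_le_holds`,
`bsd_minimisation_three_holds`), Bhargava–Shankar's Theorem 5.6, Theorem 1.1 and Cor. 1.2
depend on exactly four named facts of the held arXiv text: Lemma 5.2 (the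
Birch–Swinnerton-Dyer correspondence, `bhargavaShankar_card_selmerTwo_eq_kEquivClassCount`),
Lemma 5.5 (minimisation at `2`, `bsd_minimisation_two`), eq. (31) with Prop. 5.12 and
Lemma 5.16 (`bhargavaShankar_sum_irredClassCount_asymptotic`) and Prop. 5.8
(`bhargavaShankar_sum_card_selmerTwo_twoTorsion_le`). -/

/-- **Bhargava–Shankar, Theorem 5.6, granted Lemma 5.2 and Lemma 5.5 only** (Lemmas 5.3, 5.4
being proved). [cite: BhargavaShankarAnnals2015, Thm 5.6 (arXiv:1006.1002v2 numbering; §5.1)] -/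
theorem bhargavaShankar_card_selmerTwo_eq_of_remaining_facts
    (h52 : bhargavaShankar_card_selmerTwo_eq_kEquivClassCount) (h55 : bsd_minimisation_two) :
    bhargavaShankar_card_selmerTwo_eq :=
  bhargavaShankar_card_selmerTwo_eq_of_facts h52 bsd_minimisation_prime_five_le_holds
    bsd_minimisation_three_holds h55

/-- **Bhargava–Shankar, Theorem 1.1, granted the four remaining printed inputs** (Lemma 5.2,
Lemma 5.5, eq. (31), Prop. 5.8). [cite: BhargavaShankarAnnals2015, Thm 1.1 (arXiv:1006.1002v2 numbering)] -/
theorem average_card_selmerTwo_of_remaining_facts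
    (h52 : bhargavaShankar_card_selmerTwo_eq_kEquivClassCount) (h55 : bsd_minimisation_two)
    (h31 : bhargavaShankar_sum_irredClassCount_asymptotic)
    (h58 : bhargavaShankar_sum_card_selmerTwo_twoTorsion_le) :
    EllipticCurves.average_card_selmerTwo :=
  average_card_selmerTwo_of_BSD_facts h52 bsd_minimisation_prime_five_le_holds
    bsd_minimisation_three_holds h55 h31 h58

/-- **Bhargava–Shankar, Cor. 1.2 (`averageRankLE_three_halves`), granted the four remaining
printed inputs**: Lemma 5.2, Lemma 5.5, eq. (31) (with Prop. 5.12, Lemma 5.16) and Prop. 5.8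
of the held arXiv text; everything else in the paper's derivation of Cor. 1.2 is proved in the
tree. [cite: BhargavaShankarAnnals2015, Cor. 1.2] -/
theorem averageRankLE_three_halves_of_remaining_facts
    (h52 : bhargavaShankar_card_selmerTwo_eq_kEquivClassCount) (h55 : bsd_minimisation_two)
    (h31 : bhargavaShankar_sum_irredClassCount_asymptotic)
    (h58 : bhargavaShankar_sum_card_selmerTwo_twoTorsion_le) :
    EllipticCurves.averageRankLE_three_halves :=
  averageRankLE_three_halves_of_BSD_facts h52 bsd_minimisation_prime_five_le_holds
    bsd_minimisation_three_holds h55 h31 h58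

end Literature.NumberTheory.EllipticCurves

end
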